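import Literature.NumberTheory.Transcendental.DrinfeldAssociatorLimit
import HarnessLib

/-!
# Hyperlogarithms on `(0,1)` over a real alphabet `{0} ∪ [1,∞)` (Poincaré–Lappo-Danilevsky–Brown)

First layer of the analytic road to `GenusZeroPeriodsMZV` (`GenusZeroPeriodsMZV.lean`,
[Brown 2009, Thm 1.1]) by integration along the fibration `𝔐_{0,n} → 𝔐_{0,n-1}` [Brown 2009,
§8.3]: the one-variable theory of **hyperlogarithms** [Brown 2009, §5.1], here for a real alphabet
`σ : α → ℝ` with every letter either AT `0` or in `[1, ∞)` (`hσ : ∀ c, σ c = 0 ∨ 1 ≤ σ c`) and a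
real argument `b ∈ (0,1)` below all nonzero letters — the situation met on each fibre of the
simplex `{1 > t₁ > ⋯ > t_ℓ > 0}` after rescaling the last variable (letters `0, 1/t_{k-1},
t_1/t_{k-1}, …, 1`). Everything is PROVED; no named fact is introduced. Built on the coefficientwise
iterated-integral calculus `iterInt` of `DrinfeldAssociatorTransport.lean` and on the two-letter
case `KZ3` of `DrinfeldAssociatorLimit.lean`, to which the general case is reduced by DOMINATION
(`iterInt_mono_densities`: a letter at `0` has density `dt/t = KZ3.P false`, a letter `σ_c ≥ 1` has
density `dt/(σ_c - t) ≤ dt/(1-t) = KZ3.P true`).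

* `Hyperlog.pden σ c t = 1/|t - σ_c|` — the POSITIVE letter densities (Brown's forms are
  `dt/(t - σ_c)` [Brown 2009, (5.2), (5.4)]; on `(0,1)` the two normalisations differ by the sign
  `(-1)^{#letters of w not at 0}`, `iterInt_signed_eq`, `tendsto_iterInt_signed`).
* `Hyperlog.IsReg σ w` — words not ending with a letter at `0` (Brown's `A*_c`, [Brown 2009, §5.1]).
* `Hyperlog.hlog σ w b = lim_{ε→0⁺} ∫_{ε<t_n<⋯<t_1<b} ∏ dtᵢ/|tᵢ - σ_{wᵢ}|` (a supremum of the
  antitone family; `tendsto_hlog`, with the rate `hlog_sub_le`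
  `0 ≤ L_w(b) - I_w(ε,b) ≤ (|w|+1)(|log ε|+|log(1-b)|+1)^{|w|} 4^{|w|} ε`) — for the alphabet
  `{σ₀ = 0, σ₁, …, σ_N}` this is (up to the sign above) Brown's hyperlogarithm `L_w(z)`, the
  solution of (5.2) with `L_w(z) → 0` as `z → σ₀` for `w ∈ A*_c` nonempty [Brown 2009, Prop. 5.1,
  (5.3), (5.4)], restricted to real `z ∈ (0,1)`.
* PROVED: Chen's identity through the regularised base point `L_w(b') = Σ_{w=uv} I_u(b,b') L_v(b)`
  (`hlog_chen`); the differential equation (5.2) `∂_b L_{cw} = L_w/|b - σ_c|`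
  (`hasDerivAt_hlog_cons`), continuity, `L_w(b) → 0` as `b → 0⁺` (`tendsto_hlog_zero`), the
  integral formula (5.4) `L_{cw}(b) = ∫_0^b L_w(t) dt/|t - σ_c|` as a genuine (absolutely convergent)
  interval integral (`hlog_cons`), the shuffle product (5.5) `L_u L_v = Σ_{w ∈ u ш v} L_w`
  (`hlog_mul_eq_sum_shuffleWord`), the bounds `0 ≤ L_w(b) ≤ (2/(1-b))^{|w|} b`; and the bridge to
  the tree: for the alphabet `{0,1}` (`boolLetters`), `hlog = KZ3.botLim` (`hlog_boolLetters_eq_botLim`)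
  and, for a convergent word `V`, `L_V(b) → ζ(V) = multipleZeta (ofBinaryWord V)` as `b → 1⁻`
  (`tendsto_hlog_boolLetters_multipleZeta`; [Brown 2009, §5.5, (5.13), Def. 5.10 `ζ(w) = Li_w(1)`]).

## Deliberately NOT here (next layers of the same road)

Words ending with the letter at `0` (`L_{a₀ⁿ} = logⁿ/n!` and the shuffle extension [Brown 2009,
§5.1 after (5.5)]); expansions and regularised values at the upper letter `b → 1⁻` for
non-convergent words; primitives of `ℝ(z) ⊗ L_w` and the fibre-integration theorem; complex letters
(TODO(general form)).

## References

* F. C. S. Brown, *Multiple zeta values and periods of moduli spaces `𝔐̄_{0,n}`*, Ann. Sci. Éc.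
  Norm. Supér. (4) 42 (2009), 371–489, §5.1 (pp. 438–440: (5.2), Prop. 5.1, (5.3)–(5.5)), §5.2,
  §5.5 (p. 444: (5.12), (5.13), Def. 5.10). doi:10.24033/asens.2099. [BrownENS2009]
* H. Poincaré; J. A. Lappo-Danilevsky, *Mémoires sur la théorie des systèmes des équations
  différentielles linéaires* (Chelsea 1953) — the explicit formula, as cited in [BrownENS2009, §5.1].
* K.-T. Chen, Bull. AMS 83 (1977), §1–2 (iterated integrals, shuffle). Standard: `[folklore]`.
-/

noncomputable section

open MeasureTheory intervalIntegral Set Filter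
open scoped BigOperators Topology

namespace Literature.NumberTheory.Transcendental

namespace Hyperlog

variable {α : Type*}

/-! ### The positive letter densities `1/|t - σ_c|` -/

/-- The POSITIVE density of the letter `c` placed at `σ c ∈ ℝ`: `1/|t - σ_c|` (`= dt/t` for the
letter at `0`, `= dt/(σ_c - t)` for a letter `σ_c ≥ 1 > t`). Brown's hyperlogarithms use the signed
forms `dt/(t - σ_c)` [Brown 2009, (5.2), (5.4)]; on `(0,1)` the two differ by the constant sign
`(-1)^{#letters placed in [1,∞)}` (`iterInt_smul_densities`). [cite: BrownENS2009, §5.1 (5.4)] -/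
def pden (σ : α → ℝ) (c : α) (t : ℝ) : ℝ := 1 / |t - σ c|

/-- Words *regular at `0`*: empty, or not ending with a letter placed at `0` (Brown's `A*_c`,
the words for which `L_w(z) → 0` as `z → 0` and the iterated integral from `0` converges
[Brown 2009, §5.1, before (5.3)]). [cite: BrownENS2009, §5.1] -/
def IsReg (σ : α → ℝ) (w : List α) : Prop := ∀ h : w ≠ [], σ (w.getLast h) ≠ 0

/-- The letter-type map to the two-letter alphabet of `KZ3`: `false` = a letter at `0` (density
`dt/t`), `true` = a letter in `[1, ∞)` (density dominated by `dt/(1-t)`). [folklore] -/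
def toBool (σ : α → ℝ) (c : α) : Bool := decide (σ c ≠ 0)

variable (σ : α → ℝ)

/-- The empty word is regular at `0`. [folklore] -/
@[simp] theorem isReg_nil : IsReg σ ([] : List α) := fun h => (h rfl).elim

/-- A singleton is regular at `0` iff its letter is not at `0`. [folklore] -/
theorem isReg_singleton {c : α} : IsReg σ [c] ↔ σ c ≠ 0 := by
  constructor
  · intro h; exact h (List.cons_ne_nil c [])
  · intro h _; simpa using h

/-- `c w` is regular at `0` iff `w` is, for `w` nonempty. [folklore] -/
theorem isReg_cons_of_ne_nil {c : α} {w : List α} (hw : w ≠ []) : IsReg σ (c :: w) ↔ IsReg σ w := by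
  constructor
  · intro h h'
    have := h (List.cons_ne_nil c w)
    rwa [List.getLast_cons hw] at this
  · intro h h'
    rw [List.getLast_cons hw]
    exact h hw

/-- The tail of a regular word is regular. [folklore] -/
theorem IsReg.tail {c : α} {w : List α} (h : IsReg σ (c :: w)) : IsReg σ w := by
  by_cases hw : w = []
  · subst hw; exact isReg_nil σ
  · exact (isReg_cons_of_ne_nil σ hw).1 h

/-- A regular word maps to a bottom word of `KZ3` (empty or ending with `true`). [folklore] -/
theorem IsReg.isBotWord_map {w : List α} (h : IsReg σ w) : KZ3.IsBotWord (w.map (toBool σ)) := by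
  by_cases hw : w = []
  · exact Or.inl (by simp [hw])
  · right
    rw [List.getLast?_eq_some_getLast (by simpa using hw), List.getLast_map]
    simp [toBool, h hw]

/-- Suffixes of regular words are regular. [folklore] -/
theorem IsReg.suffix {v : List α} (u w : List α) (h : IsReg σ v) (huw : u ++ w = v) : IsReg σ w := by
  subst huw
  intro hw
  have := h (by simp [hw])
  rwa [List.getLast_append_of_ne_nil _ hw] at this

section Basic

variable {σ} (hσ : ∀ c, σ c = 0 ∨ 1 ≤ σ c)
include hσ

omit hσ in
/-- For a letter at `0`: `pden c t = 1/t` on `(0,1)`. [folklore] -/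
theorem pden_of_eq_zero {c : α} (hc : σ c = 0) {t : ℝ} (ht : 0 < t) : pden σ c t = 1 / t := by
  rw [pden, hc, sub_zero, abs_of_pos ht]

/-- For a letter not at `0` (hence in `[1,∞)`): `pden c t = 1/(σ_c - t)` on `(0,1)`. [folklore] -/
theorem pden_of_ne_zero {c : α} (hc : σ c ≠ 0) {t : ℝ} (ht : t < 1) :
    pden σ c t = 1 / (σ c - t) := by
  have h1 : 1 ≤ σ c := (hσ c).resolve_left hc
  rw [pden, abs_of_neg (by linarith), neg_sub]

/-- Comparison with the two KZ densities: `pden c t ≤ P (toBool c) t` on `(0,1)`, with equality for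
a letter at `0`. [folklore] -/
theorem pden_le_P (c : α) {t : ℝ} (ht : t ∈ Ioo (0 : ℝ) 1) : pden σ c t ≤ KZ3.P (toBool σ c) t := by
  by_cases hc : σ c = 0
  · simp only [toBool, hc, ne_eq, not_true_eq_false, decide_false, KZ3.P_false]
    rw [pden_of_eq_zero hc ht.1]
  · simp only [toBool, hc, ne_eq, not_false_eq_true, decide_true, KZ3.P_true]
    rw [pden_of_ne_zero hσ hc ht.2]
    have h1 : 1 ≤ σ c := (hσ c).resolve_left hc
    exact one_div_le_one_div_of_le (by linarith [ht.2]) (by linarith)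

omit hσ in
/-- The densities are nonnegative (on `(0,1)`, say). [folklore] -/
theorem pden_nonneg (c : α) (t : ℝ) (_ : t ∈ Ioo (0 : ℝ) 1) : 0 ≤ pden σ c t := by
  unfold pden; positivity

/-- The densities are continuous on `(0,1)` (no letter lies in `(0,1)`). [folklore] -/
theorem continuousOn_pden (c : α) : ContinuousOn (pden σ c) (Ioo 0 1) := by
  refine continuousOn_of_forall_continuousAt fun t ht => ?_
  have hne : t - σ c ≠ 0 := by
    rcases hσ c with hc | hc
    · rw [hc, sub_zero]; exact ht.1.ne'
    · exact sub_ne_zero.2 (ne_of_lt (lt_of_lt_of_le ht.2 hc))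
  unfold pden
  exact continuousAt_const.div ((continuousAt_id.sub continuousAt_const).abs) (abs_pos.2 hne).ne'

omit hσ in
/-- **Comparison of iterated integrals across an alphabet map**: nonnegative densities dominated
letterwise by densities on another alphabet have smaller iterated integrals. [folklore] -/
theorem iterInt_mono_densities {β : Type*} {f : α → ℝ → ℝ} {g : β → ℝ → ℝ} (κ : α → β)
    {s : Set ℝ} (hs : IsOpen s) (hso : s.OrdConnected) (hfc : ∀ c, ContinuousOn (f c) s)
    (hgc : ∀ d, ContinuousOn (g d) s) (hf : ∀ c, ∀ t ∈ s, 0 ≤ f c t)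
    (hfg : ∀ c, ∀ t ∈ s, f c t ≤ g (κ c) t) {a : ℝ} (ha : a ∈ s) :
    ∀ (w : List α) {b : ℝ}, b ∈ s → a ≤ b → iterInt f w a b ≤ iterInt g (w.map κ) a b
  | [], _, _, _ => le_rfl
  | c :: w, b, hb, hab => by
    rw [List.map_cons, iterInt_cons, iterInt_cons]
    refine intervalIntegral.integral_mono_on hab
      (intervalIntegrable_mul_iterInt hs hso hfc ha c w ha hb)
      (intervalIntegrable_mul_iterInt hs hso hgc ha (κ c) (w.map κ) ha hb) fun t ht => ?_
    have hts : t ∈ s := hso.uIcc_subset ha hb (by rw [uIcc_of_le hab]; exact ht)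
    exact mul_le_mul (hfg c t hts) (iterInt_mono_densities κ hs hso hfc hgc hf hfg ha w hts ht.1)
      (iterInt_nonneg hso hf ha w hts ht.1) ((hf c t hts).trans (hfg c t hts))

omit hσ in
/-- The list of letter types has the same length. [folklore] -/
theorem length_map_toBool (w : List α) : (w.map (toBool σ)).length = w.length := List.length_map _

/-- **Domination by the KZ iterated integrals**: `I^{pden}_w(a,b) ≤ I^{P}_{toBool w}(a,b)` on
`[a,b] ⊆ (0,1)`. [folklore] -/
theorem iterInt_pden_le_P (w : List α) {a b : ℝ} (ha : 0 < a) (hab : a ≤ b) (hb : b < 1) :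
    iterInt (pden σ) w a b ≤ iterInt KZ3.P (w.map (toBool σ)) a b :=
  iterInt_mono_densities (toBool σ) KZ3.isOpen_Ioo01 KZ3.ordConnected_Ioo01 (continuousOn_pden hσ)
    KZ3.continuousOn_P pden_nonneg (pden_le_P hσ) ⟨ha, hab.trans_lt hb⟩ w
    ⟨ha.trans_le hab, hb⟩ hab

omit hσ in
/-- Nonnegativity of the iterated integrals of the positive densities. [folklore] -/
theorem iterInt_pden_nonneg (w : List α) {a b : ℝ} (ha : 0 < a) (hab : a ≤ b) (hb : b < 1) :
    0 ≤ iterInt (pden σ) w a b :=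
  iterInt_nonneg KZ3.ordConnected_Ioo01 pden_nonneg ⟨ha, hab.trans_lt hb⟩ w
    ⟨ha.trans_le hab, hb⟩ hab

/-- The crude bound `I_w(a,b) ≤ (|log a| + |log(1-b)|)^{|w|}`. [folklore] -/
theorem iterInt_pden_le_pow (w : List α) {a b : ℝ} (ha : 0 < a) (hab : a ≤ b) (hb : b < 1) :
    iterInt (pden σ) w a b ≤ (|Real.log a| + |Real.log (1 - b)|) ^ w.length := by
  refine (iterInt_pden_le_P hσ w ha hab hb).trans ?_
  simpa only [length_map_toBool] using KZ3.iterInt_P_le_pow (w.map (toBool σ)) ha hab hb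

/-- **Smallness at `0`** for a nonempty word regular at `0`: `I_w(a,x) ≤ (2/(1-x))^{|w|} x`.
[folklore] -/
theorem iterInt_pden_le_of_isReg {w : List α} (hw : w ≠ []) (hreg : IsReg σ w) {a x : ℝ}
    (ha : 0 < a) (hax : a ≤ x) (hx : x < 1) :
    iterInt (pden σ) w a x ≤ (2 / (1 - x)) ^ w.length * x := by
  refine (iterInt_pden_le_P hσ w ha hax hx).trans ?_
  have hne : w.map (toBool σ) ≠ [] := by simpa using hw
  have hl : (w.map (toBool σ)).getLast hne = true := by
    rw [List.getLast_map]; simpa [toBool] using hreg hw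
  simpa only [length_map_toBool] using KZ3.iterInt_P_le_of_getLast hne hl ha hax hx

/-- Uniform bound `I_w(ε,b) ≤ (2/(1-b))^{|w|}` for a word regular at `0`. [folklore] -/
theorem iterInt_pden_le_of_isReg' {w : List α} (hreg : IsReg σ w) {ε b : ℝ} (hε : 0 < ε)
    (hεb : ε ≤ b) (hb : b < 1) : iterInt (pden σ) w ε b ≤ (2 / (1 - b)) ^ w.length := by
  by_cases hne : w = []
  · subst hne; simp
  · refine (iterInt_pden_le_of_isReg hσ hne hreg hε hεb hb).trans ?_
    have hM : (0 : ℝ) ≤ (2 / (1 - b)) ^ w.length := by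
      have : 0 < 1 - b := by linarith
      positivity
    calc (2 / (1 - b)) ^ w.length * b ≤ (2 / (1 - b)) ^ w.length * 1 :=
          mul_le_mul_of_nonneg_left hb.le hM
      _ = _ := mul_one _

/-- The family `ε ↦ I_w(ε,b)` is antitone. [folklore] -/
theorem antitoneOn_iterInt_pden (w : List α) {b : ℝ} (hb : b ∈ Ioo (0 : ℝ) 1) :
    AntitoneOn (fun ε => iterInt (pden σ) w ε b) (Ioo 0 b) := by
  intro ε' hε' ε hε hle
  exact iterInt_anti_left KZ3.isOpen_Ioo01 KZ3.ordConnected_Ioo01 (continuousOn_pden hσ)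
    pden_nonneg ⟨hε'.1, hε'.2.trans hb.2⟩ ⟨hε.1, hε.2.trans hb.2⟩ hb hle hε.2.le w

end Basic

/-! ### The hyperlogarithm `L_w(b) = lim_{ε→0⁺} I_w(ε, b)` -/

/-- **The (positive) hyperlogarithm** of the word `w` at `b ∈ (0,1)`:
`L_w(b) = lim_{ε → 0⁺} ∫_{ε < t_n < ⋯ < t_1 < b} ∏ dtᵢ/|tᵢ - σ_{wᵢ}|` (a supremum; the limit exists for
words regular at `0`, `tendsto_hlog`). For the alphabet `{0, σ₁, …, σ_N} ⊂ {0} ∪ [1,∞)` this is, up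
to the sign `(-1)^{#{i : w_i ≠ 0-letter}}`, Brown's hyperlogarithm `L_w(z)`, the unique solution of
`∂_z L_{a_k w} = L_w/(z - σ_k)` with `L_w(z) → 0` (`z → 0`, `w` not a power of `a₀`)
[Brown 2009, §5.1, (5.2)–(5.4); Poincaré, Lappo-Danilevsky]; here restricted to real
`z ∈ (0,1)` below all nonzero letters (TODO(general form): complex letters and arguments, words
ending in `a₀` through the shuffle regularisation `L_{a₀ⁿ} = logⁿ(z)/n!`).
[cite: BrownENS2009, §5.1 eq. (5.4)] -/
def hlog (σ : α → ℝ) (w : List α) (b : ℝ) : ℝ :=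
  sSup ((fun ε => iterInt (pden σ) w ε b) '' Ioo 0 b)

section Limit

variable {σ} (hσ : ∀ c, σ c = 0 ∨ 1 ≤ σ c)
include hσ

/-- The family `ε ↦ I_w(ε,b)` is bounded above for a word regular at `0`. [folklore] -/
theorem bddAbove_iterInt {w : List α} (hw : IsReg σ w) {b : ℝ} (hb : b ∈ Ioo (0 : ℝ) 1) :
    BddAbove ((fun ε => iterInt (pden σ) w ε b) '' Ioo 0 b) := by
  refine ⟨(2 / (1 - b)) ^ w.length, ?_⟩
  rintro _ ⟨ε, hε, rfl⟩
  exact iterInt_pden_le_of_isReg' hσ hw hε.1 hε.2.le hb.2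

/-- **Existence of the regularised iterated integral from `0`**: `I_w(ε,b) → L_w(b)` as `ε → 0⁺`
for a word regular at `0` [Brown 2009, §5.1 "this is a convergent iterated integral, even though
the base point `σ₀` does not lie in the space"]. [cite: BrownENS2009, §5.2 (ρ_{σ₀})] -/
theorem tendsto_hlog {w : List α} (hw : IsReg σ w) {b : ℝ} (hb : b ∈ Ioo (0 : ℝ) 1) :
    Tendsto (fun ε => iterInt (pden σ) w ε b) (𝓝[>] 0) (𝓝 (hlog σ w b)) :=
  (antitoneOn_iterInt_pden hσ w hb).tendsto_nhdsWithin_Ioo_right (nonempty_Ioo.mpr hb.1)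
    (bddAbove_iterInt hσ hw hb)

/-- `I_w(ε,b) ≤ L_w(b)`. [folklore] -/
theorem iterInt_le_hlog {w : List α} (hw : IsReg σ w) {ε b : ℝ} (hb : b ∈ Ioo (0 : ℝ) 1)
    (hε : ε ∈ Ioo 0 b) : iterInt (pden σ) w ε b ≤ hlog σ w b :=
  le_csSup (bddAbove_iterInt hσ hw hb) ⟨ε, hε, rfl⟩

/-- `L_w(b) ≤ (2/(1-b))^{|w|}`. [folklore] -/
theorem hlog_le {w : List α} (hw : IsReg σ w) {b : ℝ} (hb : b ∈ Ioo (0 : ℝ) 1) :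
    hlog σ w b ≤ (2 / (1 - b)) ^ w.length :=
  csSup_le ((nonempty_Ioo.mpr hb.1).image _) (by
    rintro _ ⟨ε, hε, rfl⟩; exact iterInt_pden_le_of_isReg' hσ hw hε.1 hε.2.le hb.2)

/-- `L_w(b) ≤ (2/(1-b))^{|w|} b` for a nonempty word (so `L_w(b) → 0` as `b → 0`). [folklore] -/
theorem hlog_le_mul {w : List α} (hne : w ≠ []) (hw : IsReg σ w) {b : ℝ} (hb : b ∈ Ioo (0 : ℝ) 1) :
    hlog σ w b ≤ (2 / (1 - b)) ^ w.length * b :=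
  csSup_le ((nonempty_Ioo.mpr hb.1).image _) (by
    rintro _ ⟨ε, hε, rfl⟩; exact iterInt_pden_le_of_isReg hσ hne hw hε.1 hε.2.le hb.2)

/-- `0 ≤ L_w(b)`. [folklore] -/
theorem hlog_nonneg {w : List α} (hw : IsReg σ w) {b : ℝ} (hb : b ∈ Ioo (0 : ℝ) 1) :
    0 ≤ hlog σ w b := by
  have hε : b / 2 ∈ Ioo 0 b := ⟨by linarith [hb.1], by linarith [hb.1]⟩
  exact (iterInt_pden_nonneg w hε.1 hε.2.le hb.2).trans (iterInt_le_hlog hσ hw hb hε)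

/-- `L_∅(b) = 1`. [folklore] -/
@[simp] theorem hlog_nil {b : ℝ} (hb : b ∈ Ioo (0 : ℝ) 1) : hlog σ ([] : List α) b = 1 := by
  refine tendsto_nhds_unique (tendsto_hlog hσ (isReg_nil σ) hb) ?_
  simp

/-- **Rate at `0`**: `I_w(ε',b) - I_w(ε,b) ≤ (|w|+1)(|log ε|+|log(1-b)|+1)^{|w|} 4^{|w|} ε` for
`0 < ε' ≤ ε ≤ min(1/2, b)` (Chen's identity at `ε` and smallness at `0` of the regular suffixes).
[folklore] -/
theorem iterInt_pden_sub_le {w : List α} (hw : IsReg σ w) {ε' ε b : ℝ} (hε' : 0 < ε')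
    (hle : ε' ≤ ε) (hε : ε ≤ 1 / 2) (hεb : ε ≤ b) (hb : b < 1) :
    iterInt (pden σ) w ε' b - iterInt (pden σ) w ε b ≤
      (w.length + 1) * ((|Real.log ε| + |Real.log (1 - b)| + 1) ^ w.length * 4 ^ w.length * ε) := by
  classical
  have hε0 : 0 < ε := hε'.trans_le hle
  have hε1 : ε < 1 := by linarith
  have hb' : b ∈ Ioo (0 : ℝ) 1 := ⟨hε0.trans_le hεb, hb⟩
  rw [iterInt_chen KZ3.isOpen_Ioo01 KZ3.ordConnected_Ioo01 (continuousOn_pden hσ) (a := ε') (b := ε)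
    ⟨hε', by linarith⟩ ⟨hε0, hε1⟩ w hb', ← Finset.add_sum_erase _ _ (NCSeries.self_nil_mem_splits w),
    iterInt_nil, mul_one, add_sub_cancel_left]
  have hcard : ((NCSeries.splits w).erase (w, [])).card ≤ w.length + 1 := by
    refine (Finset.card_erase_le).trans ?_
    rw [NCSeries.splits, Finset.card_map]; simp
  refine (Finset.sum_le_card_nsmul _ _
    ((|Real.log ε| + |Real.log (1 - b)| + 1) ^ w.length * 4 ^ w.length * ε) ?_).trans ?_
  · intro p hp
    obtain ⟨hne, hp⟩ := Finset.mem_erase.mp hp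
    rw [NCSeries.mem_splits] at hp
    have hp2 : p.2 ≠ [] := by
      intro h2; apply hne; ext1
      · simpa [h2] using hp
      · exact h2
    have hreg2 : IsReg σ p.2 := hw.suffix σ p.1 p.2 hp
    have hlen1 : p.1.length ≤ w.length := by
      have := congrArg List.length hp; simp at this; omega
    have hlen2 : p.2.length ≤ w.length := by
      have := congrArg List.length hp; simp at this; omega
    have h1 : iterInt (pden σ) p.1 ε b ≤ (|Real.log ε| + |Real.log (1 - b)| + 1) ^ w.length :=
      ((iterInt_pden_le_pow hσ p.1 hε0 hεb hb).trans (pow_le_pow_left₀ (by positivity)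
        (by linarith) _)).trans
        (pow_le_pow_right₀ (by linarith [abs_nonneg (Real.log ε), abs_nonneg (Real.log (1 - b))])
          hlen1)
    have h2 : iterInt (pden σ) p.2 ε' ε ≤ 4 ^ w.length * ε := by
      refine (iterInt_pden_le_of_isReg hσ hp2 hreg2 hε' hle hε1).trans ?_
      refine mul_le_mul_of_nonneg_right ?_ hε0.le
      calc (2 / (1 - ε)) ^ p.2.length ≤ 4 ^ p.2.length := by
            refine pow_le_pow_left₀ (by positivity) ?_ _
            rw [div_le_iff₀ (by linarith)]; linarith
        _ ≤ 4 ^ w.length := pow_le_pow_right₀ (by norm_num) hlen2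
    calc iterInt (pden σ) p.1 ε b * iterInt (pden σ) p.2 ε' ε
        ≤ (|Real.log ε| + |Real.log (1 - b)| + 1) ^ w.length * (4 ^ w.length * ε) :=
          mul_le_mul h1 h2 (iterInt_pden_nonneg _ hε' hle hε1) (by positivity)
      _ = _ := by ring
  · rw [nsmul_eq_mul]
    refine mul_le_mul_of_nonneg_right ?_ (by positivity)
    exact_mod_cast hcard

/-- **The limit with its rate**: `0 ≤ L_w(b) - I_w(ε,b) ≤ (|w|+1)(|log ε|+|log(1-b)|+1)^{|w|} 4^{|w|} ε`
(`0 < ε ≤ 1/2`, `ε < b < 1`). [folklore] -/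
theorem hlog_sub_le {w : List α} (hw : IsReg σ w) {ε b : ℝ} (hε0 : 0 < ε) (hε : ε ≤ 1 / 2)
    (hεb : ε < b) (hb : b < 1) :
    hlog σ w b - iterInt (pden σ) w ε b ≤
      (w.length + 1) * ((|Real.log ε| + |Real.log (1 - b)| + 1) ^ w.length * 4 ^ w.length * ε) := by
  have hb' : b ∈ Ioo (0 : ℝ) 1 := ⟨hε0.trans hεb, hb⟩
  have ht : Tendsto (fun ε' => iterInt (pden σ) w ε' b - iterInt (pden σ) w ε b) (𝓝[>] 0)
      (𝓝 (hlog σ w b - iterInt (pden σ) w ε b)) := (tendsto_hlog hσ hw hb').sub_const _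
  refine le_of_tendsto ht ?_
  filter_upwards [Ioo_mem_nhdsGT hε0] with ε' hε'
  exact iterInt_pden_sub_le hσ hw hε'.1 hε'.2.le hε hεb.le hb

/-- `0 ≤ L_w(b) - I_w(ε,b)`. [folklore] -/
theorem sub_nonneg_hlog {w : List α} (hw : IsReg σ w) {ε b : ℝ} (hb : b ∈ Ioo (0 : ℝ) 1)
    (hε : ε ∈ Ioo 0 b) : 0 ≤ hlog σ w b - iterInt (pden σ) w ε b :=
  sub_nonneg.2 (iterInt_le_hlog hσ hw hb hε)

end Limit

/-! ### Chen's identity for `L_w`, the differential equation (5.2) and the integral formula (5.4) -/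

section Calculus

variable {σ} (hσ : ∀ c, σ c = 0 ∨ 1 ≤ σ c)
include hσ

/-- **Chen's identity through the regularised base point**:
`L_w(b') = Σ_{w = uv} I_u(b,b') L_v(b)` for `b, b' ∈ (0,1)`. [folklore] -/
theorem hlog_chen {w : List α} (hw : IsReg σ w) {b b' : ℝ} (hb : b ∈ Ioo (0 : ℝ) 1)
    (hb' : b' ∈ Ioo (0 : ℝ) 1) :
    hlog σ w b' = ∑ p ∈ NCSeries.splits w, iterInt (pden σ) p.1 b b' * hlog σ p.2 b := by
  have hlim : Tendsto (fun ε => ∑ p ∈ NCSeries.splits w, iterInt (pden σ) p.1 b b' *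
      iterInt (pden σ) p.2 ε b) (𝓝[>] 0)
      (𝓝 (∑ p ∈ NCSeries.splits w, iterInt (pden σ) p.1 b b' * hlog σ p.2 b)) := by
    refine tendsto_finsetSum _ fun p hp => Tendsto.const_mul _ (tendsto_hlog hσ ?_ hb)
    exact hw.suffix σ p.1 p.2 (NCSeries.mem_splits.mp hp)
  refine tendsto_nhds_unique (tendsto_hlog hσ hw hb') (hlim.congr' ?_)
  filter_upwards [Ioo_mem_nhdsGT (lt_min hb.1 hb'.1)] with ε hε
  exact (iterInt_chen KZ3.isOpen_Ioo01 KZ3.ordConnected_Ioo01 (continuousOn_pden hσ) (a := ε) (b := b)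
    ⟨hε.1, (hε.2.trans_le (min_le_left _ _)).trans hb.2⟩ hb w hb').symm

/-- **The differential equation** `∂_b L_{cw}(b) = L_w(b)/|b - σ_c|` on `(0,1)` [Brown 2009, (5.2)].
[cite: BrownENS2009, §5.1 eq. (5.2)] -/
theorem hasDerivAt_hlog_cons {c : α} {w : List α} (hw : IsReg σ (c :: w)) {b : ℝ}
    (hb : b ∈ Ioo (0 : ℝ) 1) :
    HasDerivAt (hlog σ (c :: w)) (pden σ c b * hlog σ w b) b := by
  classical
  -- near `b`, `L_{cw}(b') = Σ_{cw = uv} I_u(b,b') L_v(b)`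
  have heq : (fun b' => ∑ p ∈ NCSeries.splits (c :: w), iterInt (pden σ) p.1 b b' * hlog σ p.2 b)
      =ᶠ[𝓝 b] hlog σ (c :: w) := by
    filter_upwards [KZ3.isOpen_Ioo01.mem_nhds hb] with b' hb'
    exact (hlog_chen hσ hw hb hb').symm
  refine HasDerivAt.congr_of_eventuallyEq ?_ heq.symm
  -- differentiate term by term
  have hderiv : ∀ p ∈ NCSeries.splits (c :: w),
      HasDerivAt (fun b' => iterInt (pden σ) p.1 b b' * hlog σ p.2 b)
        ((match p.1 with
          | [] => 0
          | d :: u => pden σ d b * iterInt (pden σ) u b b) * hlog σ p.2 b) b := by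
    intro p _
    refine HasDerivAt.mul_const ?_ _
    rcases p with ⟨u, v⟩
    cases u with
    | nil =>
      show HasDerivAt (fun b' => iterInt (pden σ) [] b b') 0 b
      simp_rw [iterInt_nil]
      exact hasDerivAt_const b 1
    | cons d u =>
      show HasDerivAt (fun b' => iterInt (pden σ) (d :: u) b b') (pden σ d b * iterInt (pden σ) u b b) b
      exact hasDerivAt_iterInt_cons KZ3.isOpen_Ioo01 KZ3.ordConnected_Ioo01 (continuousOn_pden hσ) hb
        d u hb
  have hsum := HasDerivAt.sum hderiv
  convert hsum using 1
  · ext b'; simp [Finset.sum_apply]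
  · rw [NCSeries.sum_splits_cons]
    simp only [zero_mul, zero_add]
    rw [← Finset.add_sum_erase _ _ (NCSeries.nil_self_mem_splits w)]
    simp only [iterInt_nil, mul_one]
    rw [Finset.sum_eq_zero, add_zero]
    intro p hp
    obtain ⟨hne, hp⟩ := Finset.mem_erase.mp hp
    have hp1 : p.1 ≠ [] := by
      intro h1; apply hne
      rw [NCSeries.mem_splits] at hp
      ext1
      · exact h1
      · simpa [h1] using hp
    simp [iterInt_self_of_ne_nil _ hp1]

/-- `L_w` is continuous on `(0,1)`. [folklore] -/
theorem continuousOn_hlog {w : List α} (hw : IsReg σ w) : ContinuousOn (hlog σ w) (Ioo 0 1) := by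
  cases w with
  | nil =>
    refine (continuousOn_const (c := (1 : ℝ))).congr fun b hb => ?_
    exact hlog_nil hσ hb
  | cons c w =>
    exact continuousOn_of_forall_continuousAt fun b hb =>
      (hasDerivAt_hlog_cons hσ hw hb).continuousAt

/-- `L_{cw}(b) - L_{cw}(a) = ∫_a^b L_w(t) dt/|t - σ_c|` for `a, b ∈ (0,1)`. [folklore] -/
theorem hlog_cons_sub {c : α} {w : List α} (hw : IsReg σ (c :: w)) {a b : ℝ}
    (ha : a ∈ Ioo (0 : ℝ) 1) (hb : b ∈ Ioo (0 : ℝ) 1) :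
    hlog σ (c :: w) b - hlog σ (c :: w) a = ∫ t in a..b, pden σ c t * hlog σ w t := by
  have hsub : uIcc a b ⊆ Ioo 0 1 := KZ3.ordConnected_Ioo01.uIcc_subset ha hb
  have hcont : ContinuousOn (fun t => pden σ c t * hlog σ w t) (Ioo 0 1) :=
    (continuousOn_pden hσ c).mul (continuousOn_hlog hσ (hw.tail σ))
  rw [intervalIntegral.integral_eq_sub_of_hasDerivAt (fun t ht => hasDerivAt_hlog_cons hσ hw (hsub ht))
    ((hcont.mono hsub).intervalIntegrable)]

/-- The integrand of (5.4) is bounded near `0`: `L_w(t)/|t - σ_c| ≤ (2/(1-t))^{|w|+1}` on `(0,1)`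
for `cw` regular at `0`. [folklore] -/
theorem pden_mul_hlog_le {c : α} {w : List α} (hw : IsReg σ (c :: w)) {t : ℝ}
    (ht : t ∈ Ioo (0 : ℝ) 1) : pden σ c t * hlog σ w t ≤ (2 / (1 - t)) ^ (w.length + 1) := by
  have h1t : 0 < 1 - t := by linarith [ht.2]
  have h2 : 1 ≤ 2 / (1 - t) := by rw [le_div_iff₀ h1t]; linarith [ht.1]
  by_cases hwn : w = []
  · subst hwn
    have hc : σ c ≠ 0 := (isReg_singleton σ).1 hw
    rw [hlog_nil hσ ht, mul_one, pden_of_ne_zero hσ hc ht.2]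
    have h1 : 1 ≤ σ c := (hσ c).resolve_left hc
    calc 1 / (σ c - t) ≤ 1 / (1 - t) := one_div_le_one_div_of_le h1t (by linarith)
      _ ≤ 2 / (1 - t) := by rw [div_le_div_iff_of_pos_right h1t]; norm_num
      _ = (2 / (1 - t)) ^ (([] : List α).length + 1) := by simp
  · have hreg : IsReg σ w := (isReg_cons_of_ne_nil σ hwn).1 hw
    have hL := hlog_le_mul hσ hwn hreg ht
    by_cases hc : σ c = 0
    · rw [pden_of_eq_zero hc ht.1]
      calc 1 / t * hlog σ w t ≤ 1 / t * ((2 / (1 - t)) ^ w.length * t) :=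
            mul_le_mul_of_nonneg_left hL (by have := ht.1; positivity)
        _ = (2 / (1 - t)) ^ w.length := by field_simp [ht.1.ne']
        _ ≤ (2 / (1 - t)) ^ (w.length + 1) := pow_le_pow_right₀ h2 (Nat.le_succ _)
    · rw [pden_of_ne_zero hσ hc ht.2]
      have h1 : 1 ≤ σ c := (hσ c).resolve_left hc
      have hp : 1 / (σ c - t) ≤ 2 / (1 - t) :=
        calc 1 / (σ c - t) ≤ 1 / (1 - t) := one_div_le_one_div_of_le h1t (by linarith)
          _ ≤ 2 / (1 - t) := by rw [div_le_div_iff_of_pos_right h1t]; norm_num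
      calc 1 / (σ c - t) * hlog σ w t ≤ 2 / (1 - t) * ((2 / (1 - t)) ^ w.length * t) :=
            mul_le_mul hp hL (hlog_nonneg hσ hreg ht) (by positivity)
        _ ≤ 2 / (1 - t) * ((2 / (1 - t)) ^ w.length * 1) := by
            refine mul_le_mul_of_nonneg_left (mul_le_mul_of_nonneg_left ht.2.le (by positivity)) ?_
            positivity
        _ = (2 / (1 - t)) ^ (w.length + 1) := by ring

/-- The integrand of (5.4) is integrable on `[0, b]`, `b < 1`. [folklore] -/
theorem intervalIntegrable_pden_mul_hlog {c : α} {w : List α} (hw : IsReg σ (c :: w)) {b : ℝ}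
    (hb : b ∈ Ioo (0 : ℝ) 1) :
    IntervalIntegrable (fun t => pden σ c t * hlog σ w t) volume 0 b := by
  have hcont : ContinuousOn (fun t => pden σ c t * hlog σ w t) (Ioo 0 1) :=
    (continuousOn_pden hσ c).mul (continuousOn_hlog hσ (hw.tail σ))
  rw [intervalIntegrable_iff_integrableOn_Ioo_of_le hb.1.le]
  have hg : IntegrableOn (fun _ : ℝ => (2 / (1 - b)) ^ (w.length + 1)) (Ioo 0 b) volume :=
    ((continuous_const).integrableOn_Icc (a := (0 : ℝ)) (b := b)).mono_set Ioo_subset_Icc_self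
  refine Integrable.mono' hg
    ((hcont.mono (Ioo_subset_Ioo_right hb.2.le)).aestronglyMeasurable measurableSet_Ioo) ?_
  · rw [ae_restrict_iff' measurableSet_Ioo]
    refine ae_of_all _ fun t ht => ?_
    have ht' : t ∈ Ioo (0 : ℝ) 1 := ⟨ht.1, ht.2.trans hb.2⟩
    rw [Real.norm_eq_abs, abs_of_nonneg (mul_nonneg (pden_nonneg c t ht') (hlog_nonneg hσ (hw.tail σ) ht'))]
    refine (pden_mul_hlog_le hσ hw ht').trans ?_
    have h1t : 0 < 1 - b := by linarith [hb.2]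
    exact pow_le_pow_left₀ (by have := ht'.2; positivity)
      (div_le_div_of_nonneg_left (by norm_num) h1t (by linarith [ht.2])) _

/-- `L_w(a) → 0` as `a → 0⁺` for a nonempty word regular at `0`. [cite: BrownENS2009, §5.1] -/
theorem tendsto_hlog_zero {w : List α} (hne : w ≠ []) (hw : IsReg σ w) :
    Tendsto (hlog σ w) (𝓝[>] 0) (𝓝 0) := by
  have hhalf : Ioo (0 : ℝ) (1 / 2) ∈ 𝓝[>] (0 : ℝ) := Ioo_mem_nhdsGT (by norm_num)
  refine squeeze_zero' (g := fun a => 4 ^ w.length * a) ?_ ?_ ?_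
  · filter_upwards [hhalf] with a ha
    exact hlog_nonneg hσ hw ⟨ha.1, by linarith [ha.2]⟩
  · filter_upwards [hhalf] with a ha
    refine (hlog_le_mul hσ hne hw ⟨ha.1, by linarith [ha.2]⟩).trans ?_
    have h1a : 0 < 1 - a := by linarith [ha.2]
    refine mul_le_mul_of_nonneg_right (pow_le_pow_left₀ (by positivity) ?_ _) ha.1.le
    rw [div_le_iff₀ h1a]; linarith [ha.2]
  · have : Tendsto (fun a : ℝ => (4 : ℝ) ^ w.length * a) (𝓝 0) (𝓝 (4 ^ w.length * 0)) :=
      tendsto_id.const_mul _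
    rw [mul_zero] at this
    exact this.mono_left nhdsWithin_le_nhds

/-- **The integral formula (5.4)**: `L_{cw}(b) = ∫_0^b L_w(t) dt/|t - σ_c|` for `cw` regular at `0`
and `b ∈ (0,1)` [Brown 2009, (5.4): `L_{a_k w}(z) = ∫_0^z L_w(t) dt/(t - σ_k)`].
[cite: BrownENS2009, §5.1 eq. (5.4)] -/
theorem hlog_cons {c : α} {w : List α} (hw : IsReg σ (c :: w)) {b : ℝ} (hb : b ∈ Ioo (0 : ℝ) 1) :
    hlog σ (c :: w) b = ∫ t in (0 : ℝ)..b, pden σ c t * hlog σ w t := by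
  -- `a ↦ ∫_a^b` is continuous on `[0,b]`, and equals `L_{cw}(b) - L_{cw}(a)` for `a ∈ (0,b]`
  have hint := intervalIntegrable_pden_mul_hlog hσ hw hb
  have hprim : ContinuousOn (fun a => ∫ t in a..b, pden σ c t * hlog σ w t) (uIcc 0 b) :=
    intervalIntegral.continuousOn_primitive_interval_left (by
      rw [uIcc_of_le hb.1.le]; exact (intervalIntegrable_iff_integrableOn_Icc_of_le hb.1.le).1 hint)
  have h0 : (0 : ℝ) ∈ uIcc 0 b := by rw [uIcc_of_le hb.1.le]; exact ⟨le_rfl, hb.1.le⟩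
  have hlim1' : Tendsto (fun a => ∫ t in a..b, pden σ c t * hlog σ w t) (𝓝[>] 0)
      (𝓝 (∫ t in (0 : ℝ)..b, pden σ c t * hlog σ w t)) := by
    have h := (hprim 0 h0).tendsto
    have hle : 𝓝[>] (0 : ℝ) ≤ 𝓝[uIcc 0 b] 0 := by
      rw [← nhdsWithin_Ioo_eq_nhdsGT hb.1]
      exact nhdsWithin_mono 0 (by rw [uIcc_of_le hb.1.le]; exact Ioo_subset_Icc_self)
    exact h.mono_left hle
  have hlim2 : Tendsto (fun a => hlog σ (c :: w) b - hlog σ (c :: w) a) (𝓝[>] 0)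
      (𝓝 (hlog σ (c :: w) b - 0)) :=
    (tendsto_hlog_zero hσ (List.cons_ne_nil c w) hw).const_sub _
  rw [sub_zero] at hlim2
  refine tendsto_nhds_unique (hlim2.congr' ?_) hlim1'
  filter_upwards [Ioo_mem_nhdsGT hb.1] with a ha
  exact hlog_cons_sub hσ hw ⟨ha.1, ha.2.trans hb.2⟩ hb

end Calculus

/-! ### The shuffle product (5.5) -/

section ShuffleProduct

variable {σ} (hσ : ∀ c, σ c = 0 ∨ 1 ≤ σ c)
include hσ

omit hσ in
/-- Interleavings of two words regular at `0` are regular at `0` (they end with the last letter of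
one of them). [folklore] -/
theorem IsReg.of_mem_shuffleWord {u v w : List α} (hu : IsReg σ u) (hv : IsReg σ v)
    (hw : w ∈ MZV.shuffleWord u v) : IsReg σ w := by
  intro hne
  have h := MZV.getLast?_of_mem_shuffleWord u v hw
  rw [List.getLast?_eq_some_getLast hne] at h
  rcases h with h | h
  · by_cases hun : u = []
    · subst hun; simp at h
    · rw [List.getLast?_eq_some_getLast hun] at h
      rw [Option.some.inj h]; exact hu hun
  · by_cases hvn : v = []
    · subst hvn; simp at h
    · rw [List.getLast?_eq_some_getLast hvn] at h
      rw [Option.some.inj h]; exact hv hvn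

/-- **The shuffle product** `L_u(b) L_v(b) = Σ_{w ∈ u ш v} L_w(b)` for words regular at `0`
[Brown 2009, (5.5): `w ↦ L_w` is a homomorphism for the shuffle product].
[cite: BrownENS2009, §5.1 eq. (5.5)] -/
theorem hlog_mul_eq_sum_shuffleWord {u v : List α} (hu : IsReg σ u) (hv : IsReg σ v) {b : ℝ}
    (hb : b ∈ Ioo (0 : ℝ) 1) :
    hlog σ u b * hlog σ v b = ((MZV.shuffleWord u v).map fun w => hlog σ w b).sum := by
  have hlim : Tendsto (fun ε => ((MZV.shuffleWord u v).map fun w => iterInt (pden σ) w ε b).sum)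
      (𝓝[>] 0) (𝓝 ((MZV.shuffleWord u v).map fun w => hlog σ w b).sum) :=
    tendsto_list_sum _ fun w hw => tendsto_hlog hσ (hu.of_mem_shuffleWord hv hw) hb
  refine tendsto_nhds_unique ((tendsto_hlog hσ hu hb).mul (tendsto_hlog hσ hv hb)) (hlim.congr' ?_)
  filter_upwards [Ioo_mem_nhdsGT hb.1] with ε hε
  exact (iterInt_mul_eq_sum_shuffleWord KZ3.isOpen_Ioo01 KZ3.ordConnected_Ioo01 (continuousOn_pden hσ)
    ⟨hε.1, hε.2.trans hb.2⟩ u v hb).symm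

end ShuffleProduct

/-! ### Brown's signed normalisation, and the two-letter case `{0, 1}` (multiple zeta values) -/

section Signed

/-- Iterated integrals only see the densities on the interval of integration. [folklore] -/
theorem iterInt_congr_of_eqOn {f g : α → ℝ → ℝ} {a b : ℝ}
    (h : ∀ c, EqOn (f c) (g c) (Icc a b)) :
    ∀ (w : List α) {x : ℝ}, x ∈ Icc a b → iterInt f w a x = iterInt g w a x
  | [], _, _ => rfl
  | c :: w, x, hx => by
    rw [iterInt_cons, iterInt_cons]
    refine intervalIntegral.integral_congr fun t ht => ?_
    rw [uIcc_of_le hx.1] at ht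
    have ht' : t ∈ Icc a b := ⟨ht.1, ht.2.trans hx.2⟩
    rw [h c ht', iterInt_congr_of_eqOn h w ht']

/-- The sign of a word: `∏_{c ∈ w} (±1) = (-1)^{#letters not at 0}`. [folklore] -/
theorem prod_map_sign (w : List α) :
    (w.map fun c => if σ c = 0 then (1 : ℝ) else -1).prod =
      (-1) ^ (w.filter fun c => decide (σ c ≠ 0)).length := by
  induction w with
  | nil => simp
  | cons c w ih =>
    rw [List.map_cons, List.prod_cons, ih, List.filter_cons]
    by_cases hc : σ c = 0
    · simp [hc]
    · simp [hc, pow_succ, mul_comm]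

/-- **Brown's signed hyperlogarithm integrals** `∫ ∏ dtᵢ/(tᵢ - σ_{wᵢ})` [Brown 2009, (5.4)] differ
from the positive ones by `(-1)^{#letters of w not at 0}` on `[a,b] ⊆ (0,1)`.
[cite: BrownENS2009, §5.1 eq. (5.4)] -/
theorem iterInt_signed_eq (hσ : ∀ c, σ c = 0 ∨ 1 ≤ σ c) (w : List α) {a b : ℝ} (ha : 0 < a)
    (hab : a ≤ b) (hb : b < 1) :
    iterInt (fun c t => 1 / (t - σ c)) w a b =
      (-1) ^ (w.filter fun c => decide (σ c ≠ 0)).length * iterInt (pden σ) w a b := by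
  have h1 : iterInt (fun c t => 1 / (t - σ c)) w a b =
      iterInt (fun c t => (if σ c = 0 then (1 : ℝ) else -1) * pden σ c t) w a b := by
    refine iterInt_congr_of_eqOn (fun c t ht => ?_) w ⟨hab, le_rfl⟩
    by_cases hc : σ c = 0
    · simp only [hc, sub_zero, if_true, one_mul]
      rw [pden_of_eq_zero hc (ha.trans_le ht.1)]
    · simp only [hc, if_false]
      rw [pden_of_ne_zero hσ hc (ht.2.trans_lt hb)]
      rw [← neg_sub, div_neg]; ring
  rw [h1, KZ3.iterInt_smul_densities, prod_map_sign]

/-- **Brown's hyperlogarithm as a regularised iterated integral from `σ₀ = 0`**: for `w` regular at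
`0` and `b ∈ (0,1)`, `∫_{ε<t_n<⋯<t_1<b} ∏ dtᵢ/(tᵢ - σ_{wᵢ}) → (-1)^{#letters not at 0} L_w(b)` as
`ε → 0⁺` [Brown 2009, (5.4) iterated from `σ₀`, and §5.2: "`ρ_{σ₀}(w)` is a convergent iterated
integral, even though the base point `σ₀` does not lie in the space"]. [cite: BrownENS2009, §5.2] -/
theorem tendsto_iterInt_signed (hσ : ∀ c, σ c = 0 ∨ 1 ≤ σ c) {w : List α} (hw : IsReg σ w) {b : ℝ}
    (hb : b ∈ Ioo (0 : ℝ) 1) :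
    Tendsto (fun ε => iterInt (fun c t => 1 / (t - σ c)) w ε b) (𝓝[>] 0)
      (𝓝 ((-1) ^ (w.filter fun c => decide (σ c ≠ 0)).length * hlog σ w b)) := by
  refine ((tendsto_hlog hσ hw hb).const_mul _).congr' ?_
  filter_upwards [Ioo_mem_nhdsGT hb.1] with ε hε
  exact (iterInt_signed_eq σ hσ w hε.1 hε.2.le hb.2).symm

/-- The two-letter alphabet `{0, 1}` of multiple zeta values: `false ↦ 0`, `true ↦ 1`. [folklore] -/
def boolLetters : Bool → ℝ := fun c => if c then 1 else 0

/-- `boolLetters` is an admissible alphabet. [folklore] -/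
theorem boolLetters_adm : ∀ c, boolLetters c = 0 ∨ 1 ≤ boolLetters c := by
  intro c; cases c <;> simp [boolLetters]

/-- On `[a,b] ⊆ (0,1)` the positive densities of `{0,1}` are the KZ densities `1/t`, `1/(1-t)`.
[folklore] -/
theorem pden_boolLetters_eqOn (c : Bool) {a b : ℝ} (ha : 0 < a) (hb : b < 1) :
    EqOn (pden boolLetters c) (KZ3.P c) (Icc a b) := by
  intro t ht
  cases c
  · rw [KZ3.P_false, pden_of_eq_zero (by simp [boolLetters]) (ha.trans_le ht.1)]
  · rw [KZ3.P_true, pden_of_ne_zero boolLetters_adm (by simp [boolLetters]) (ht.2.trans_lt hb)]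
    simp [boolLetters]

/-- A binary word is regular at `0` iff it is a bottom word of `KZ3`. [folklore] -/
theorem isReg_boolLetters_iff (w : List Bool) : IsReg boolLetters w ↔ KZ3.IsBotWord w := by
  constructor
  · intro h
    simpa [toBool, boolLetters, List.map_id''] using h.isBotWord_map
  · intro h hne
    rw [h.getLast_eq hne]; simp [boolLetters]

/-- **The case `{0,1}`**: the hyperlogarithms of the alphabet `{0,1}` on `(0,1)` are the regularised KZ
iterated integrals `KZ3.botLim` of the tree (the multiple polylogarithms in one variable
`Li_w(z)`, [Brown 2009, (5.12)–(5.13)]). [cite: BrownENS2009, §5.5 eq. (5.12)] -/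
theorem hlog_boolLetters_eq_botLim (w : List Bool) {b : ℝ} (hb : b ∈ Ioo (0 : ℝ) 1) :
    hlog boolLetters w b = KZ3.botLim w b := by
  unfold hlog KZ3.botLim
  congr 1
  refine image_congr fun ε hε => ?_
  exact iterInt_congr_of_eqOn (fun c => pden_boolLetters_eqOn c hε.1 hb.2) w ⟨hε.2.le, le_rfl⟩

/-- **Multiple zeta values as limits of hyperlogarithms**: for a convergent binary word `V`
(`x ⋯ y`), `L_V(b) → ζ(V) = multipleZeta (ofBinaryWord V)` as `b → 1⁻` [Brown 2009, (5.13),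
Def. 5.10 `ζ(w) = Li_w(1)`]. [cite: BrownENS2009, §5.5 Def. 5.10] -/
theorem tendsto_hlog_boolLetters_multipleZeta {V : List Bool} (hV : KZ3.IsConvWord V) :
    Tendsto (hlog boolLetters V) (𝓝[<] 1) (𝓝 (multipleZeta (MZV.ofBinaryWord V))) := by
  rw [← KZ3.Z_eq_multipleZeta hV]
  refine (KZ3.tendsto_botLim_Z hV).congr' ?_
  filter_upwards [Ioo_mem_nhdsLT (zero_lt_one' ℝ)] with b hb
  exact (hlog_boolLetters_eq_botLim V hb).symm

end Signed

end Hyperlog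

end Literature.NumberTheory.Transcendental
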